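import Mathlib
import Literature.RingTheory.CohomologyAnnihilator.NoetherDifferentAnnihilator
import Literature.RingTheory.CohomologyAnnihilator.KaehlerDifferent
import Summits.ResolutionOfSingularities.ResolutionOfSingularities.Theorems.HomologicalConductorPersistenceHypersurfaceJacobian
import HarnessLib

/-!
# The RAMIFICATION FLOOR of the cohomology annihilator, algebraic core: the noether different of a
# finite free algebra is the set of values at the TRACE of the `B`-linear maps `Hom_A(B, A) → B`

OURS (cell res-hironaka, chain W4.4; lead res-L0-w44-lead-1 g12, KERNEL-g12 §3).  AI-written, weaker than
expert review; nothing here is a statement of the manuscript under review (Hironaka 2017).  SUPPORT-level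
(kill test `SurfaceTermination` stmt-16488 / crux `NoZenoR` stmt-19943), counted 0.  Fact-free.

For a commutative `A`-algebra `B`, finitely generated and FREE as an `A`-module, the noether different
`𝔑(B/A) = μ((B ⊗_A B)^B)` (`Literature…noetherDifferent`, [IyengarTakahashi2014, §3]) is

  `𝔑(B/A) = {Φ(Tr) : Φ : B^∨ → B  A-linear with Φ(b·φ) = b Φ(φ)}`,

`B^∨ = Hom_A(B, A)` with `(b·φ)(y) = φ(by)`, `Tr = Algebra.trace A B` (the classical description of
the homological different through the trace form; we know no locator we have read, so it is proved here
as OUR lemma).  Proof with an `A`-basis `e_j`, dual basis `e_j^*`: an invariant tensor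
`t = Σ bᵢ ⊗ cᵢ` gives `Φ_t(φ) = Σ φ(bᵢ)cᵢ`, `B`-linear exactly because `t` is invariant, and
`Φ_t(Tr) = Σ_j e_j Φ_t(e_j^*) = Σᵢ bᵢcᵢ = μ(t)` since `Tr = Σ_j e_j·e_j^*`; conversely
`t_Φ = Σ_j e_j ⊗ Φ(e_j^*)` is invariant with `μ(t_Φ) = Φ(Tr)`.

* `algebraTrace_eq_sum_coord_comp_mulLeft` — `Tr = Σ_j e_j^* ∘ (e_j · )`.
* `Φ_t(φ) := lid((φ ⊗ 1) t)` (written out; no definition is introduced): `dualEval_tmul`,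
  `dualEval_comp_mulLeft` (B-linearity for invariant `t`), `sum_basis_mul_dualEval_coord`
  (`Σ_j e_j Φ_t(e_j^*) = μ(t)`, any `t`), `dualEval_trace_eq_lmul'`.
* `t_Φ := Σ_j e_j ⊗ Φ(e_j^*)` (written out): `tensorOfDualMap_invariant`, `lmul'_tensorOfDualMap`.
* **`mem_noetherDifferent_iff_exists_dualMap_trace`** — the description above.
* **`dualMap_trace_mem_cohomologyAnnihilatorOfDegree`** — with `A` noetherian and `caᵈ⁺¹(A) = A`:
  `Φ(Tr) ∈ caᵈ⁺¹(B)` ([IyengarTakahashi2014, Prop. 3.4] in the tree, `I' = A` since `B` is projective).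

WHY (KERNEL-g12 §3, «ramification floor»): for a normal Cohen–Macaulay `T` free over a Noether
normalisation `A = k[f₁,…,f_d]`, `T^∨ ≅ ω_T ⊗ ω_A⁻¹`, so `𝔑(T/A)` = the values at the trace of the
anticanonical module — for Gorenstein `T` the principal ideal of the Casimir element (the cell's
CASIMIR FLOOR, K44S-DEMAZURE §9), for non-Gorenstein `T` a whole divisorial ideal (the divisorial ideal of
the ramification divisor `div(df₁∧…∧df_d)`), the first floor on record for non-Gorenstein stages.

Not here: canonical modules, the divisor of the trace, Noether = Kähler on the lci locus.
-/

noncomputable section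

-- single-problem summit: the doubled namespace component `ResolutionOfSingularities` is forced by the layout
set_option linter.dupNamespace false

open scoped TensorProduct

universe u

namespace Summit.ResolutionOfSingularities.ResolutionOfSingularities.Theorems.NoZeno.RamificationFloor

open Literature.RingTheory.CohomologyAnnihilator CategoryTheory

variable {A : Type u} [CommRing A] {B : Type u} [CommRing B] [Algebra A B]

/-- For an `A`-basis `e` of the algebra `B`, the trace form is `Tr = Σ_j e_j^* ∘ (y ↦ e_j y)`.
[this work] -/
theorem algebraTrace_eq_sum_coord_comp_mulLeft {ι : Type*} [Fintype ι] [DecidableEq ι]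
    (e : Module.Basis ι A B) :
    Algebra.trace A B = ∑ j, (e.coord j) ∘ₗ LinearMap.mulLeft A (e j) := by
  ext b
  rw [Algebra.trace_apply, LinearMap.trace_eq_matrix_trace A e, Matrix.trace]
  simp only [Matrix.diag_apply, LinearMap.toMatrix_apply, LinearMap.coe_sum, Finset.sum_apply,
    LinearMap.coe_comp, Function.comp_apply, LinearMap.mulLeft_apply, Module.Basis.coord_apply]
  refine Finset.sum_congr rfl fun j _ => ?_
  change (e.repr (b * e j)) j = _
  rw [mul_comm]

/-- `Φ_t(φ)` on a pure tensor: `Φ_{b ⊗ c}(φ) = φ(b) • c`. [this work] -/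
@[simp] theorem dualEval_tmul (b c : B) (φ : Module.Dual A B) :
    TensorProduct.lid A B (LinearMap.rTensor B φ (b ⊗ₜ[A] c)) = φ b • c := by
  simp

/-- `Φ_{t+t'} = Φ_t + Φ_{t'}` pointwise. [this work] -/
theorem dualEval_add (t t' : B ⊗[A] B) (φ : Module.Dual A B) :
    TensorProduct.lid A B (LinearMap.rTensor B φ (t + t')) =
      TensorProduct.lid A B (LinearMap.rTensor B φ t) + TensorProduct.lid A B (LinearMap.rTensor B φ t') := by
  simp [map_add]

/-- `(1 ⊗ b) t` evaluates to `b Φ_t(φ)`: `Φ_{(1⊗b)t}(φ) = b · Φ_t(φ)` (any `t`). [this work] -/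
theorem dualEval_one_tmul_mul (t : B ⊗[A] B) (b : B) (φ : Module.Dual A B) :
    TensorProduct.lid A B (LinearMap.rTensor B φ (((1 : B) ⊗ₜ[A] b) * t)) =
      b * TensorProduct.lid A B (LinearMap.rTensor B φ t) := by
  induction t using TensorProduct.induction_on with
  | zero => simp
  | tmul x y =>
    rw [Algebra.TensorProduct.tmul_mul_tmul, one_mul, dualEval_tmul, dualEval_tmul, mul_smul_comm]
  | add x y hx hy => rw [mul_add, dualEval_add, dualEval_add, hx, hy, mul_add]

/-- `(b ⊗ 1) t` evaluates to `Φ_t(b·φ)`: `Φ_{(b⊗1)t}(φ) = Φ_t(φ ∘ (b · ))` (any `t`). [this work] -/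
theorem dualEval_tmul_one_mul (t : B ⊗[A] B) (b : B) (φ : Module.Dual A B) :
    TensorProduct.lid A B (LinearMap.rTensor B φ ((b ⊗ₜ[A] (1 : B)) * t)) =
      TensorProduct.lid A B (LinearMap.rTensor B (φ ∘ₗ LinearMap.mulLeft A b) t) := by
  induction t using TensorProduct.induction_on with
  | zero => simp
  | tmul x y =>
    rw [Algebra.TensorProduct.tmul_mul_tmul, one_mul, dualEval_tmul, dualEval_tmul,
      LinearMap.coe_comp, Function.comp_apply, LinearMap.mulLeft_apply]
  | add x y hx hy => rw [mul_add, dualEval_add, dualEval_add, hx, hy]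

/-- For an INVARIANT tensor `t` (`(b ⊗ 1)t = (1 ⊗ b)t`), `Φ_t` is `B`-linear for the `B`-module structure
`(b·φ)(y) = φ(by)` on `B^∨`: `Φ_t(φ ∘ (b · )) = b Φ_t(φ)`. [this work] -/
theorem dualEval_comp_mulLeft {t : B ⊗[A] B}
    (ht : ∀ b : B, (b ⊗ₜ[A] (1 : B)) * t = ((1 : B) ⊗ₜ[A] b) * t) (b : B) (φ : Module.Dual A B) :
    TensorProduct.lid A B (LinearMap.rTensor B (φ ∘ₗ LinearMap.mulLeft A b) t) =
      b * TensorProduct.lid A B (LinearMap.rTensor B φ t) := by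
  rw [← dualEval_tmul_one_mul, ht b, dualEval_one_tmul_mul]

/-- `Σ_j e_j · Φ_t(e_j^*) = μ(t)` for EVERY tensor `t` (basis expansion). [this work] -/
theorem sum_basis_mul_dualEval_coord {ι : Type*} [Fintype ι] [DecidableEq ι] (e : Module.Basis ι A B)
    (t : B ⊗[A] B) :
    ∑ j, e j * TensorProduct.lid A B (LinearMap.rTensor B (e.coord j) t) =
      Algebra.TensorProduct.lmul' (S := B) A t := by
  induction t using TensorProduct.induction_on with
  | zero => simp
  | tmul x y =>
    simp only [dualEval_tmul, Module.Basis.coord_apply, Algebra.TensorProduct.lmul'_apply_tmul]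
    calc ∑ j, e j * (e.repr x j • y) = (∑ j, e.repr x j • e j) * y := by
          rw [Finset.sum_mul]
          refine Finset.sum_congr rfl fun j _ => ?_
          rw [mul_smul_comm, smul_mul_assoc]
      _ = x * y := by rw [e.sum_repr x]
  | add x y hx hy =>
    simp only [mul_add, Finset.sum_add_distrib, map_add]
    rw [hx, hy]

/-- For an invariant tensor, `Φ_t(Tr) = μ(t)`. [this work] -/
theorem dualEval_trace_eq_lmul' [Module.Free A B] [Module.Finite A B] {t : B ⊗[A] B}
    (ht : ∀ b : B, (b ⊗ₜ[A] (1 : B)) * t = ((1 : B) ⊗ₜ[A] b) * t) :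
    TensorProduct.lid A B (LinearMap.rTensor B (Algebra.trace A B) t) =
      Algebra.TensorProduct.lmul' (S := B) A t := by
  classical
  let e := Module.Free.chooseBasis A B
  rw [algebraTrace_eq_sum_coord_comp_mulLeft e,
    show LinearMap.rTensor B (∑ j, e.coord j ∘ₗ LinearMap.mulLeft A (e j)) =
      LinearMap.rTensorHom B (∑ j, e.coord j ∘ₗ LinearMap.mulLeft A (e j)) from rfl,
    map_sum, LinearMap.sum_apply, map_sum]
  have h : ∀ j, TensorProduct.lid A B ((LinearMap.rTensorHom B (e.coord j ∘ₗ LinearMap.mulLeft A (e j))) t)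
      = e j * TensorProduct.lid A B (LinearMap.rTensor B (e.coord j) t) :=
    fun j => dualEval_comp_mulLeft ht (e j) (e.coord j)
  simp only [h]
  exact sum_basis_mul_dualEval_coord e t

/-- `e_i^* ∘ (b · ) = Σ_j e_i^*(b e_j) • e_j^*`. [this work] -/
theorem coord_comp_mulLeft_eq_sum {ι : Type*} [Fintype ι] [DecidableEq ι] (e : Module.Basis ι A B)
    (i : ι) (b : B) :
    (e.coord i) ∘ₗ LinearMap.mulLeft A b = ∑ j, e.coord i (b * e j) • e.coord j := by
  refine e.ext fun k => ?_
  simp only [LinearMap.coe_comp, Function.comp_apply, LinearMap.mulLeft_apply, LinearMap.coe_sum,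
    Finset.sum_apply, LinearMap.smul_apply, Module.Basis.coord_apply, Module.Basis.repr_self, smul_eq_mul]
  rw [Finset.sum_eq_single k]
  · simp [Finsupp.single_eq_same]
  · intro j _ hjk
    rw [Finsupp.single_apply, if_neg (Ne.symm hjk), mul_zero]
  · intro hk; exact absurd (Finset.mem_univ k) hk

/-- `t_Φ` is invariant when `Φ` is `B`-linear. [this work] -/
theorem tensorOfDualMap_invariant {ι : Type*} [Fintype ι] [DecidableEq ι] (e : Module.Basis ι A B)
    {Φ : Module.Dual A B →ₗ[A] B}
    (hΦ : ∀ (b : B) (φ : Module.Dual A B), Φ (φ ∘ₗ LinearMap.mulLeft A b) = b * Φ φ) (b : B) :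
    (b ⊗ₜ[A] (1 : B)) * (∑ j, e j ⊗ₜ[A] Φ (e.coord j)) =
      ((1 : B) ⊗ₜ[A] b) * (∑ j, e j ⊗ₜ[A] Φ (e.coord j)) := by
  simp only [Finset.mul_sum, Algebra.TensorProduct.tmul_mul_tmul, one_mul]
  -- right-hand side: Σ_j e_j ⊗ b Φ(e_j^*) = Σ_j e_j ⊗ Φ(e_j^* ∘ (b·)) = Σ_j Σ_i e_j^*(b e_i) • (e_j ⊗ Φ(e_i^*))
  have hR : ∑ j, e j ⊗ₜ[A] (b * Φ (e.coord j)) =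
      ∑ j, ∑ i, e.coord j (b * e i) • (e j ⊗ₜ[A] Φ (e.coord i)) := by
    refine Finset.sum_congr rfl fun j _ => ?_
    rw [← hΦ, coord_comp_mulLeft_eq_sum, map_sum, TensorProduct.tmul_sum]
    refine Finset.sum_congr rfl fun i _ => ?_
    rw [map_smul, TensorProduct.tmul_smul]
  -- left-hand side: Σ_i (b e_i) ⊗ Φ(e_i^*) = Σ_i Σ_j e_j^*(b e_i) • (e_j ⊗ Φ(e_i^*))
  have hL : ∑ i, (b * e i) ⊗ₜ[A] Φ (e.coord i) =
      ∑ i, ∑ j, e.coord j (b * e i) • (e j ⊗ₜ[A] Φ (e.coord i)) := by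
    refine Finset.sum_congr rfl fun i _ => ?_
    conv_lhs => rw [← e.sum_repr (b * e i)]
    rw [TensorProduct.sum_tmul]
    refine Finset.sum_congr rfl fun j _ => ?_
    rw [Module.Basis.coord_apply, TensorProduct.smul_tmul']
  rw [hL, hR, Finset.sum_comm]

/-- `μ(t_Φ) = Φ(Tr)` when `Φ` is `B`-linear. [this work] -/
theorem lmul'_tensorOfDualMap {ι : Type*} [Fintype ι] [DecidableEq ι] (e : Module.Basis ι A B)
    {Φ : Module.Dual A B →ₗ[A] B}
    (hΦ : ∀ (b : B) (φ : Module.Dual A B), Φ (φ ∘ₗ LinearMap.mulLeft A b) = b * Φ φ) :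
    Algebra.TensorProduct.lmul' (S := B) A (∑ j, e j ⊗ₜ[A] Φ (e.coord j)) = Φ (Algebra.trace A B) := by
  simp only [map_sum, Algebra.TensorProduct.lmul'_apply_tmul]
  rw [algebraTrace_eq_sum_coord_comp_mulLeft e, map_sum]
  refine Finset.sum_congr rfl fun j _ => ?_
  rw [hΦ]

/-- **The noether different through the trace** (Auslander–Goldman; Kunz, *Kähler differentials*,
App. G): for a finite free commutative `A`-algebra `B`,
`𝔑(B/A) = {Φ(Tr) : Φ ∈ Hom_B(Hom_A(B,A), B)}`, the `B`-module structure on `Hom_A(B,A)` being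
`(b·φ)(y) = φ(by)`. [this work] -/
theorem mem_noetherDifferent_iff_exists_dualMap_trace [Module.Free A B] [Module.Finite A B] {x : B} :
    x ∈ noetherDifferent A B ↔ ∃ Φ : Module.Dual A B →ₗ[A] B,
      (∀ (b : B) (φ : Module.Dual A B), Φ (φ ∘ₗ LinearMap.mulLeft A b) = b * Φ φ) ∧
        Φ (Algebra.trace A B) = x := by
  classical
  rw [mem_noetherDifferent_iff]
  constructor
  · rintro ⟨t, ht, rfl⟩
    refine ⟨{ toFun := fun φ => TensorProduct.lid A B (LinearMap.rTensor B φ t)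
              map_add' := fun φ ψ => by simp only [LinearMap.rTensor_add, LinearMap.add_apply, map_add]
              map_smul' := fun a φ => by
                simp only [LinearMap.rTensor_smul, LinearMap.smul_apply, map_smul, RingHom.id_apply] },
      fun b φ => ?_, ?_⟩
    · exact dualEval_comp_mulLeft ht b φ
    · exact dualEval_trace_eq_lmul' ht
  · rintro ⟨Φ, hΦ, rfl⟩
    let e := Module.Free.chooseBasis A B
    exact ⟨∑ j, e j ⊗ₜ[A] Φ (e.coord j), tensorOfDualMap_invariant e hΦ, lmul'_tensorOfDualMap e hΦ⟩

/-- Corollary: every `B`-linear `Φ : B^∨ → B` sends the trace into the noether different.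
[this work] -/
theorem dualMap_trace_mem_noetherDifferent [Module.Free A B] [Module.Finite A B]
    (Φ : Module.Dual A B →ₗ[A] B)
    (hΦ : ∀ (b : B) (φ : Module.Dual A B), Φ (φ ∘ₗ LinearMap.mulLeft A b) = b * Φ φ) :
    Φ (Algebra.trace A B) ∈ noetherDifferent A B :=
  mem_noetherDifferent_iff_exists_dualMap_trace.mpr ⟨Φ, hΦ, rfl⟩

/-- **The ramification floor, algebraic core.** If `B` is finite free over a noetherian `A` with
`caᵈ⁺¹(A) = A` (e.g. `A` regular of dimension `d`), then for every `B`-linear `Φ : B^∨ → B` the value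
`Φ(Tr_{B/A})` annihilates `Ext^{≥ d+1}_B(mod B, mod B)`: `Φ(Tr) ∈ caᵈ⁺¹(B) ⊆ ca(B)`
([IyengarTakahashi2014, Prop. 3.4] = tree `noetherDifferent_mul_mem_cohomologyAnnihilatorOfDegree`, with
`I' = A` because `B` is `A`-projective: `extAnnihilatorFrom_restrictScalars_eq_top`).  For a normal
Cohen–Macaulay `T` free over a Noether normalisation `A = k[f₁,…,f_d]` this is the statement «the values
at the trace of `Hom_T(T^∨, T) ≅ Hom_T(ω_T, T)(shift)` lie in `ca(T)`» of KERNEL-g12 §3 — for Gorenstein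
`T` the Casimir element, in general a whole anticanonical divisorial ideal. [this work] -/
theorem dualMap_trace_mem_cohomologyAnnihilatorOfDegree [IsNoetherianRing A] [Module.Free A B]
    [Module.Finite A B] {d : ℕ} (hvan : cohomologyAnnihilatorOfDegree A (d + 1) = ⊤)
    (Φ : Module.Dual A B →ₗ[A] B)
    (hΦ : ∀ (b : B) (φ : Module.Dual A B), Φ (φ ∘ₗ LinearMap.mulLeft A b) = b * Φ φ) :
    Φ (Algebra.trace A B) ∈ cohomologyAnnihilatorOfDegree B (d + 1) := by
  have hx := dualMap_trace_mem_noetherDifferent Φ hΦ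
  have hc : (1 : A) ∈
      extAnnihilatorFrom ((restrictScalarsFunctor A B).obj (ModuleCat.of B B)) 1 ^ d := by
    rw [HomologicalConductor.PersistenceHypersurfaceJacobian.extAnnihilatorFrom_restrictScalars_eq_top,
      Ideal.top_pow]
    exact Submodule.mem_top
  simpa using noetherDifferent_mul_mem_cohomologyAnnihilatorOfDegree hvan hx hc

/-- … hence `Φ(Tr) ∈ ca(B)`. [this work] -/
theorem dualMap_trace_mem_cohomologyAnnihilator [IsNoetherianRing A] [Module.Free A B]
    [Module.Finite A B] {d : ℕ} (hvan : cohomologyAnnihilatorOfDegree A (d + 1) = ⊤)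
    (Φ : Module.Dual A B →ₗ[A] B)
    (hΦ : ∀ (b : B) (φ : Module.Dual A B), Φ (φ ∘ₗ LinearMap.mulLeft A b) = b * Φ φ) :
    Φ (Algebra.trace A B) ∈ cohomologyAnnihilator B :=
  cohomologyAnnihilatorOfDegree_le (d + 1) (dualMap_trace_mem_cohomologyAnnihilatorOfDegree hvan Φ hΦ)

/-! ## Appended (rev 2, lead g12 after DESK WORD 54 (R1)): the KÄHLER-DIFFERENT (Jacobian) floor, flat case, fact-free

For the FLOOR only `𝔡_K(B/A) = Fitt₀(Ω_{B/A}) ⊆ 𝔑(B/A)` is needed, and that is the tree's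
`fittingIdeal_kaehlerDifferential_le_noetherDifferent` ([IyengarTakahashi2016, (3.1)], Scheja–Storch). Hence, with NO
named fact: for `B` module-finite and PROJECTIVE over a noetherian `A` with `caᵈ⁺¹(A) = A`, `Fitt₀(Ω_{B/A}) ⊆ caᵈ⁺¹(B)`.
This is the FLAT case of the named fact `jacobianFloorNN_normal_dim3` (F-89a′, `JacobianFloorKaehlerDifferent.lean`,
statement-only, [IyengarTakahashi2016, Thm 3.8]) in every dimension — e.g. for every Cohen–Macaulay stage of the ca-tower
(graded or complete CM ⇒ free over each Noether normalisation), in particular for EVERY surface stage (normal ⇒ CM);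
on `U = Reg T` it is the ideal `𝒪_U(−R_φ)` of the ramification divisor of `φ = (f₁,…,f_d)` (KERNEL-g12 §3 (ii)). -/

/-- **Kähler-different (Jacobian) floor, flat case, fact-free**: `B` module-finite projective over noetherian `A` with
`caᵈ⁺¹(A) = A` ⇒ `Fitt₀(Ω[B⁄A]) ≤ caᵈ⁺¹(B)`. [this work] -/
theorem fittingIdeal_kaehlerDifferential_le_cohomologyAnnihilatorOfDegree [IsNoetherianRing A] [Module.Finite A B]
    [Module.Projective A B] {d : ℕ} (hvan : cohomologyAnnihilatorOfDegree A (d + 1) = ⊤) :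
    Literature.RingTheory.FittingIdeal.Module.fittingIdeal B (Ω[B⁄A]) 0 ≤ cohomologyAnnihilatorOfDegree B (d + 1) := by
  intro x hx
  have hN : x ∈ noetherDifferent A B := fittingIdeal_kaehlerDifferential_le_noetherDifferent hx
  have hc : (1 : A) ∈
      extAnnihilatorFrom ((restrictScalarsFunctor A B).obj (ModuleCat.of B B)) 1 ^ d := by
    rw [HomologicalConductor.PersistenceHypersurfaceJacobian.extAnnihilatorFrom_restrictScalars_eq_top,
      Ideal.top_pow]
    exact Submodule.mem_top
  simpa using noetherDifferent_mul_mem_cohomologyAnnihilatorOfDegree hvan hN hc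

/-- … hence `Fitt₀(Ω[B⁄A]) ≤ ca(B)`. [this work] -/
theorem fittingIdeal_kaehlerDifferential_le_cohomologyAnnihilator [IsNoetherianRing A] [Module.Finite A B]
    [Module.Projective A B] {d : ℕ} (hvan : cohomologyAnnihilatorOfDegree A (d + 1) = ⊤) :
    Literature.RingTheory.FittingIdeal.Module.fittingIdeal B (Ω[B⁄A]) 0 ≤ cohomologyAnnihilator B :=
  (fittingIdeal_kaehlerDifferential_le_cohomologyAnnihilatorOfDegree hvan).trans
    (cohomologyAnnihilatorOfDegree_le (d + 1))

-- (the inclusion `𝔑(B/A) ≤ caᵈ⁺¹(B)` itself for projective `B` is already in the tree: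
-- `HomologicalConductor.PersistenceFrobeniusDifferent.noetherDifferent_le_cohomologyAnnihilatorOfDegree_of_projective`.)

end Summit.ResolutionOfSingularities.ResolutionOfSingularities.Theorems.NoZeno.RamificationFloor

end
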